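import Summits.Ventures.DiscreteObjects.PP12.FlagSevenColOrbits
import Summits.Ventures.DiscreteObjects.PP12.FlagSevenRowOrbits

/-!
# Index sets of the flag-cell orbit matrix for an ARBITRARY number `ρ` of c-line orbits (kernel; Step A of the generic FlagOrbitReduction)
Framing: lottery ticket; floor = certified bounds/negative ranges.

Cell pub-namedobj (venture DiscreteObjects), target (M), designs gen 15; generic sibling of `FlagTenIndexSets` / `FlagSevenIndexSets`.
Setting: projective plane of order 12, collineation `σ` with `σ³ = 1` of flag type (all fixed points on the fixed line `l`, all fixed lines
through the fixed point `c ∈ l`) with exactly `13 − 3ρ` fixed points. Instead of choosing two c-lines `u₀, u₁` (`f = 7`) or one (`f = 10`),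
the c-line orbits are handled as the finite SET `CIdx c` of orbits of non-fixed lines through `c`, each with a chosen representative
`rep Γ ∋ c`; this makes every statement uniform in `ρ`:
* `card_clines_not_fixed_add` — `#(non-fixed lines through c) + f = 13`; with `f = 13 − 3ρ` (and `c` fixed, so `3ρ ≤ 12`,
  `three_rho_le`): `3ρ` non-fixed c-lines, `ρ` c-line orbits (`card_cIdx`), dually `ρ` orbits of non-fixed points of `l` (`card_zIdx_rho`),
  `12 − 3ρ` fixed lines `≠ l` and fixed points `≠ c` (`card_fixLIdx_rho`, `card_fixPIdx_rho`);
* `rep`, `rep_spec`, `rep_not_mem_orb3_rep` — representatives of the c-line orbits; two different orbits have representatives in different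
  orbits, which is exactly the hypothesis shape `u₁ ∉ orb3 u₀` of `FlagSevenIndexSets.not_both_classes`;
* `exists_cIdx_of_cline`, `exterior_orbit_meets_rep` — every non-fixed c-line lies in the orbit of some representative, and every exterior
  orbit-triangle has a vertex on some representative (its class);
* the `Fin`-indexed versions `eC`, `repF`, `eTriR`, `eZR`, `eFixLR`, `eFixPR` (`Fin ρ`, `Fin 12`, `Fin (12 − 3ρ)`; the four orbits on each
  `m_j` / through each `y_k` are `FlagTenDataFin.eOrbOn` / `eLOrb`, valid for every `f`), with `repF_not_mem_orb3`, `triIdxR_class_unique`,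
  `exists_class_of_exterior`, `exists_class_of_cline`.
No `sorry`, no new axioms.
-/

namespace Summit.Ventures.DiscreteObjects.PP12

open Configuration Finset
open scoped Classical

namespace Collineation

variable {P L : Type*} [Membership P L] [ProjectivePlane P L] [Fintype P] [Fintype L] (σ : Collineation P L)

/-- orbits of the non-fixed lines through `c` (the index set of the c-line orbits `Γ_s`) -/
abbrev CIdx (c : P) : Type _ := ((univ.filter fun u : L => c ∈ u ∧ σ.onLines u ≠ u).image (orb3 σ.onLines) : Finset (Finset L))

omit [ProjectivePlane P L] [Fintype L] in
/-- A fixed point makes `fixedCard ≥ 1`. -/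
theorem one_le_fixedCard {c : P} (hc : σ.onPoints c = c) : 1 ≤ fixedCard σ.onPoints := by
  unfold fixedCard
  exact card_pos.2 ⟨c, mem_filter.2 ⟨mem_univ _, hc⟩⟩

omit [ProjectivePlane P L] [Fintype L] in
/-- With `c` fixed, `f = 13 − 3ρ` forces `3ρ ≤ 12` (so `f − 1 = 12 − 3ρ` without truncation). -/
theorem three_rho_le {c : P} (hc : σ.onPoints c = c) {ρ : ℕ} (hf : fixedCard σ.onPoints = 13 - 3 * ρ) : 3 * ρ ≤ 12 := by
  have := σ.one_le_fixedCard hc; omega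

section Flag

variable {l : L} {c : P} (hl : σ.onLines l = l) (hc : σ.onPoints c = c) (hcl : c ∈ l)
  (hP : ∀ p : P, σ.onPoints p = p → p ∈ l) (hL : ∀ m : L, σ.onLines m = m → c ∈ m)
  (h12 : ProjectivePlane.order P L = 12)

include hL h12 in
/-- **`#(non-fixed lines through c) + f = 13`** (all fixed lines pass through `c`; Baer `f = g`). -/
theorem card_clines_not_fixed_add :
    (univ.filter fun u : L => c ∈ u ∧ σ.onLines u ≠ u).card + fixedCard σ.onPoints = 13 := by
  have hall : (univ.filter fun u : L => c ∈ u).card = 13 := by rw [card_lines_through, h12]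
  have hsplit := Finset.card_filter_add_card_filter_not (s := univ.filter fun u : L => c ∈ u) (fun u => σ.onLines u = u)
  rw [Finset.filter_filter, Finset.filter_filter, hall] at hsplit
  have h1 : (univ.filter fun u : L => c ∈ u ∧ σ.onLines u = u) = univ.filter fun u : L => σ.onLines u = u := by
    ext u; simp only [mem_filter, mem_univ, true_and]; exact ⟨fun h => h.2, fun h => ⟨hL u h, h⟩⟩
  have h2 : (univ.filter fun u : L => c ∈ u ∧ σ.onLines u ≠ u) = univ.filter fun u : L => c ∈ u ∧ ¬ σ.onLines u = u := rfl
  rw [h1] at hsplit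
  have hfl : (univ.filter fun u : L => σ.onLines u = u).card = fixedCard σ.onPoints := by
    rw [σ.fixedCard_points_eq_lines]; rfl
  rw [hfl] at hsplit
  rw [h2]; omega

include hc hL h12 in
/-- **Exactly `3ρ` lines through `c` are not fixed** (`f = 13 − 3ρ`). -/
theorem card_clines_not_fixed_rho {ρ : ℕ} (hf : fixedCard σ.onPoints = 13 - 3 * ρ) :
    (univ.filter fun u : L => c ∈ u ∧ σ.onLines u ≠ u).card = 3 * ρ := by
  have h := σ.card_clines_not_fixed_add hL h12 (c := c)
  have h3 := σ.three_rho_le hc hf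
  omega

include hc hL h12 in
/-- **The non-fixed lines through `c` form `ρ` orbits** (`σ³ = 1`). -/
theorem card_cIdx (hq : σ.onPoints ^ 3 = 1) {ρ : ℕ} (hf : fixedCard σ.onPoints = 13 - 3 * ρ) : Fintype.card (σ.CIdx c) = ρ := by
  rw [Fintype.card_coe]
  have hqL : σ.onLines ^ 3 = 1 := σ.onLines_pow_eq_one hq
  have hcσ : ∀ v : L, c ∈ v → c ∈ σ.onLines v := fun v hv => by have := σ.mem_map hv; rwa [hc] at this
  have hS : ∀ u ∈ (univ.filter fun u : L => c ∈ u ∧ σ.onLines u ≠ u),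
      σ.onLines u ∈ (univ.filter fun u : L => c ∈ u ∧ σ.onLines u ≠ u) := by
    intro u hu; rw [mem_filter] at hu ⊢
    exact ⟨mem_univ _, hcσ u hu.2.1, fun e => hu.2.2 (σ.onLines.injective e)⟩
  have hnf : ∀ u ∈ (univ.filter fun u : L => c ∈ u ∧ σ.onLines u ≠ u), σ.onLines u ≠ u := fun u hu => (mem_filter.1 hu).2.2
  have h := card_image_orb3 σ.onLines hqL _ hS hnf
  rw [σ.card_clines_not_fixed_rho hc hL h12 hf] at h
  omega

include hl hP h12 in
/-- **The non-fixed points of `l` form `ρ` orbits `Z_t`** (dual count). -/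
theorem card_zIdx_rho (hq : σ.onPoints ^ 3 = 1) {ρ : ℕ} (hf : fixedCard σ.onPoints = 13 - 3 * ρ) : Fintype.card (σ.ZIdx l) = ρ := by
  rw [Fintype.card_coe]
  have hqd : ProjectivePlane.order (Dual L) (Dual P) = 12 := by rw [ProjectivePlane.Dual.order]; exact h12
  have hf' : fixedCard σ.dual.onPoints = 13 - 3 * ρ := by
    change fixedCard σ.onLines = 13 - 3 * ρ; rw [← σ.fixedCard_points_eq_lines]; exact hf
  have hqL : σ.dual.onPoints ^ 3 = 1 := σ.onLines_pow_eq_one hq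
  have h := σ.dual.card_cIdx (c := (l : Dual L)) hl hP hqd hqL hf'
  rw [Fintype.card_coe] at h
  exact h

include hl hc in
/-- `12 − 3ρ` fixed lines `≠ l` (`f = 13 − 3ρ`). -/
theorem card_fixLIdx_rho {ρ : ℕ} (hf : fixedCard σ.onPoints = 13 - 3 * ρ) : Fintype.card (σ.FixLIdx l) = 12 - 3 * ρ := by
  rw [Fintype.card_subtype, σ.card_fixedLines_ne hl, hf]
  have := σ.three_rho_le hc hf; omega

omit [ProjectivePlane P L] [Fintype L] in
include hc in
/-- `12 − 3ρ` fixed points `≠ c` (`f = 13 − 3ρ`). -/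
theorem card_fixPIdx_rho {ρ : ℕ} (hf : fixedCard σ.onPoints = 13 - 3 * ρ) : Fintype.card (σ.FixPIdx c) = 12 - 3 * ρ := by
  rw [Fintype.card_subtype, σ.card_fixedPoints_ne hc, hf]
  have := σ.three_rho_le hc hf; omega

/-! ### Representatives of the c-line orbits -/

/-- A chosen line of the c-line orbit `Γ`. -/
noncomputable def rep (Γ : σ.CIdx c) : L := (mem_image.1 Γ.2).choose

omit [ProjectivePlane P L] [Fintype P] in
/-- `rep Γ` passes through `c`, is not fixed, and generates `Γ`. -/
theorem rep_spec (Γ : σ.CIdx c) : c ∈ σ.rep Γ ∧ σ.onLines (σ.rep Γ) ≠ σ.rep Γ ∧ orb3 σ.onLines (σ.rep Γ) = Γ.1 := by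
  have h := (mem_image.1 Γ.2).choose_spec
  rw [mem_filter] at h
  exact ⟨h.1.2.1, h.1.2.2, h.2⟩

/-- **Representatives of different c-line orbits lie in different orbits** (`σ³ = 1`). -/
theorem rep_not_mem_orb3_rep (hq : σ.onPoints ^ 3 = 1) {Γ Γ' : σ.CIdx c} (h : Γ ≠ Γ') : σ.rep Γ' ∉ orb3 σ.onLines (σ.rep Γ) := by
  intro hmem
  have hqL : σ.onLines ^ 3 = 1 := σ.onLines_pow_eq_one hq
  apply h
  apply Subtype.ext
  rw [← (σ.rep_spec Γ).2.2, ← (σ.rep_spec Γ').2.2]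
  exact (orb3_eq_of_mem σ.onLines hqL hmem).symm

/-- Every non-fixed line through `c` lies in the orbit of the representative of its orbit. -/
theorem exists_cIdx_of_cline (hq : σ.onPoints ^ 3 = 1) {u : L} (hcu : c ∈ u) (hu : σ.onLines u ≠ u) :
    ∃ Γ : σ.CIdx c, u ∈ orb3 σ.onLines (σ.rep Γ) := by
  have hqL : σ.onLines ^ 3 = 1 := σ.onLines_pow_eq_one hq
  have hmem : orb3 σ.onLines u ∈ (univ.filter fun u : L => c ∈ u ∧ σ.onLines u ≠ u).image (orb3 σ.onLines) :=
    mem_image.2 ⟨u, mem_filter.2 ⟨mem_univ _, hcu, hu⟩, rfl⟩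
  refine ⟨⟨orb3 σ.onLines u, hmem⟩, ?_⟩
  have h := (σ.rep_spec ⟨orb3 σ.onLines u, hmem⟩).2.2
  -- `rep` lies in `orb3 u`, hence `u` lies in `orb3 rep`
  have hrep : σ.rep ⟨orb3 σ.onLines u, hmem⟩ ∈ orb3 σ.onLines u := by
    have : σ.rep ⟨orb3 σ.onLines u, hmem⟩ ∈ orb3 σ.onLines (σ.rep ⟨orb3 σ.onLines u, hmem⟩) := self_mem_orb3 _ _
    rw [h] at this; exact this
  rw [orb3_eq_of_mem σ.onLines hqL hrep]
  exact self_mem_orb3 _ _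

include hl hcl in
/-- **Every exterior orbit-triangle has a vertex on the representative of some c-line orbit** (its class): the c-line of an exterior
point `Q` is not fixed, and transporting `Q` along the orbit of that c-line puts a point of `orb3 Q` on the representative. -/
theorem exterior_orbit_meets_rep (hq : σ.onPoints ^ 3 = 1) {Q : P} (hQX : ∀ m : L, σ.onLines m = m → Q ∉ m) :
    ∃ Γ : σ.CIdx c, ∃ x ∈ orb3 σ.onPoints Q, x ∈ σ.rep Γ := by
  have hQc : Q ≠ c := fun e => hQX l hl (e ▸ hcl)
  set u : L := HasLines.mkLine hQc with hu
  have hQu : Q ∈ u := (HasLines.mkLine_ax hQc).1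
  have hcu : c ∈ u := (HasLines.mkLine_ax hQc).2
  have hnu : σ.onLines u ≠ u := fun e => hQX u e hQu
  have hqL : σ.onLines ^ 3 = 1 := σ.onLines_pow_eq_one hq
  have h3 : ∀ v : L, σ.onLines (σ.onLines (σ.onLines v)) = v := apply_three σ.onLines hqL
  obtain ⟨Γ, hΓ⟩ := σ.exists_cIdx_of_cline hq hcu hnu
  refine ⟨Γ, ?_⟩
  -- `u = σ^k (rep Γ)`; move `Q` back by `σ^{-k}`
  rw [mem_orb3] at hΓ
  rcases hΓ with e | e | e
  · exact ⟨Q, self_mem_orb3 _ _, e ▸ hQu⟩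
  · refine ⟨σ.onPoints (σ.onPoints Q), (mem_orb3 _ _ _).2 (Or.inr (Or.inr rfl)), ?_⟩
    have := σ.mem_map (σ.mem_map hQu); rw [e, h3] at this; exact this
  · refine ⟨σ.onPoints Q, (mem_orb3 _ _ _).2 (Or.inr (Or.inl rfl)), ?_⟩
    have := σ.mem_map hQu; rw [e, h3] at this; exact this

/-! ### The `Fin`-indexed versions -/

section Data

variable (hq : σ.onPoints ^ 3 = 1) {ρ : ℕ} (hf : fixedCard σ.onPoints = 13 - 3 * ρ)

/-- `Fin ρ ≃` c-line orbits. -/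
noncomputable def eC : Fin ρ ≃ σ.CIdx c := (Fintype.equivFinOfCardEq (σ.card_cIdx hc hL h12 hq hf)).symm
/-- The representative c-line of class `s : Fin ρ`. -/
noncomputable def repF (s : Fin ρ) : L := σ.rep (σ.eC hc hL h12 hq hf s)
/-- `Fin ρ ≃` orbits of non-fixed points of `l`. -/
noncomputable def eZR : Fin ρ ≃ σ.ZIdx l := (Fintype.equivFinOfCardEq (σ.card_zIdx_rho hl hP h12 hq hf)).symm
/-- `Fin (12 − 3ρ) ≃` fixed lines `≠ l`. -/
noncomputable def eFixLR : Fin (12 - 3 * ρ) ≃ σ.FixLIdx l := (Fintype.equivFinOfCardEq (σ.card_fixLIdx_rho hl hc hf)).symm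
/-- `Fin (12 − 3ρ) ≃` fixed points `≠ c`. -/
noncomputable def eFixPR : Fin (12 - 3 * ρ) ≃ σ.FixPIdx c := (Fintype.equivFinOfCardEq (σ.card_fixPIdx_rho hc hf)).symm
/-- `Fin 12 ≃` the triangles of class `s` (points `≠ c` of `repF s`). -/
noncomputable def eTriR (s : Fin ρ) : Fin 12 ≃ TriIdx (P := P) c (σ.repF hc hL h12 hq hf s) :=
  (Fintype.equivFinOfCardEq (card_triIdx (P := P) h12 (σ.rep_spec (σ.eC hc hL h12 hq hf s)).1)).symm

/-- `repF s` passes through `c` and is not fixed. -/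
theorem repF_spec (s : Fin ρ) : c ∈ σ.repF hc hL h12 hq hf s ∧ σ.onLines (σ.repF hc hL h12 hq hf s) ≠ σ.repF hc hL h12 hq hf s :=
  ⟨(σ.rep_spec _).1, (σ.rep_spec _).2.1⟩

/-- Representatives of different classes lie in different orbits. -/
theorem repF_not_mem_orb3 {s s' : Fin ρ} (hss : s ≠ s') : σ.repF hc hL h12 hq hf s' ∉ orb3 σ.onLines (σ.repF hc hL h12 hq hf s) :=
  σ.rep_not_mem_orb3_rep hq fun e => hss ((σ.eC hc hL h12 hq hf).injective e)

/-- A vertex of class `s` (a point `≠ c` of `repF s`) is exterior. -/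
theorem exterior_of_triIdxR (s : Fin ρ) (x : TriIdx (P := P) c (σ.repF hc hL h12 hq hf s)) : ∀ m : L, σ.onLines m = m → x.1 ∉ m :=
  σ.exterior_of_mem_cline hL (σ.repF_spec hc hL h12 hq hf s).1 (σ.repF_spec hc hL h12 hq hf s).2 x.2.1 x.2.2

/-- **No triangle has vertices of two classes:** a point `≠ c` of `repF s` in the orbit of a vertex of class `s' ≠ s` is impossible. -/
theorem triIdxR_class_unique {s s' : Fin ρ} (hss : s ≠ s') (x' : TriIdx (P := P) c (σ.repF hc hL h12 hq hf s'))
    {p : P} (hp : p ∈ orb3 σ.onPoints x'.1) (hpu : p ∈ σ.repF hc hL h12 hq hf s) : False :=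
  σ.not_both_classes hc hq (σ.repF_spec hc hL h12 hq hf s').1 (σ.repF_spec hc hL h12 hq hf s').2 (σ.repF_spec hc hL h12 hq hf s).1
    (σ.repF_not_mem_orb3 hc hL h12 hq hf fun e => hss e.symm) (self_mem_orb3 _ x'.1) x'.2.1 x'.2.2 hp hpu

include hl hcl in
/-- **Every exterior orbit has a vertex of some class** (`Fin`-indexed). -/
theorem exists_class_of_exterior {Q : P} (hQX : ∀ m : L, σ.onLines m = m → Q ∉ m) :
    ∃ s : Fin ρ, ∃ x ∈ orb3 σ.onPoints Q, x ∈ σ.repF hc hL h12 hq hf s := by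
  obtain ⟨Γ, x, hx, hxΓ⟩ := σ.exterior_orbit_meets_rep hl hcl hq hQX
  refine ⟨(σ.eC hc hL h12 hq hf).symm Γ, x, hx, ?_⟩
  unfold repF; rw [Equiv.apply_symm_apply]; exact hxΓ

/-- **Every non-fixed c-line lies in the orbit of some class representative** (`Fin`-indexed). -/
theorem exists_class_of_cline {u : L} (hcu : c ∈ u) (hu : σ.onLines u ≠ u) :
    ∃ s : Fin ρ, u ∈ orb3 σ.onLines (σ.repF hc hL h12 hq hf s) := by
  obtain ⟨Γ, hΓ⟩ := σ.exists_cIdx_of_cline hq hcu hu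
  refine ⟨(σ.eC hc hL h12 hq hf).symm Γ, ?_⟩
  unfold repF; rw [Equiv.apply_symm_apply]; exact hΓ

end Data

end Flag

end Collineation

end Summit.Ventures.DiscreteObjects.PP12
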